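import Mathlib
import HarnessLib
import Summits.ResolutionOfSingularities.ResolutionOfSingularities.Theorems.HomologicalConductorPersistenceLostCertificate
import Summits.ResolutionOfSingularities.ResolutionOfSingularities.Theorems.HomologicalConductorPersistenceStableAnnihilatorMF

/-!
# §H2L SPECIMEN U12: `z² ∉ caⁿ(A₃ × line)` — the first kernel-certified failure of the product rule
# `ca(V × line) = ca(V)·T`, with an explicit `6 × 6` matrix factorisation and a 3-term certificate

Route `ResolutionOfSingularities/HomologicalConductor`, chain W4.4b (crux `Persistence`
stmt-ResolutionOfSingularities-16484), object **U12** = res-L1-w44b-plan-1's `L/w44b/U12-SPEC.md`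
cb1015f17bb401e9 (2026-08-27T10:05Z), typed by res-D-pv-026.  [OURS · L1 w44b; AI-written, weaker than
expert review; NOT a statement of the manuscript under study, and no statement of that manuscript is used.]

`S = k[x,y,z,t]` (`x = X 0`, `y = X 1`, `z = X 2`, `t = X 3`), `f = xy − z⁴`, `T = S ⧸ (f)` («`A₃ × line`»).
WITNESS (Knörrer double of the `k[[t]]`-lattice `(k[[t]]³, z ↦ t·J₃)`): with `J = E₁₂ + E₂₃`,
`ψ_N = z³I + z²tJ + zt²J²`,
`Φ = [[zI − tJ, −xI],[yI, −ψ_N]]`, `Ψ = [[−ψ_N, xI],[−yI, zI − tJ]]`, `ΦΨ = ΨΦ = (xy − z⁴)·I₆`.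
CERTIFICATE: the functional `μ(X) = coeff_{t²}(X₁₃) + coeff_{zt}(X₂₃) + coeff_{z²}(X₃₃)` kills every
`GΨ` (column 3 of `Ψ` is `(−zt², −z²t, −z³, 0, 0, −y)`) and every `ΦE` (telescoping over rows 1–3), while
`μ(z²·I₆) = 1`; so `z²·I₆ ∉ {GΨ + ΦE}` over ANY commutative ring `k`, and by the §H2L pipeline
(`LostCertificate.not_mem_cohomologyAnnihilatorOfDegree_of_not_exists_certificate` = U10 ∘ U7c ∘ CA1)
`z̄² ∉ caⁿ(T)` for every `n` (any field `k`), although `z² ∈ ca(A₃)` on the surface (R4).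

* `Phi`, `Psi`, `Phi_mul_Psi`, `Psi_mul_Phi` (the factorisation; 72 + 72 polynomial identities);
* `no_certificate` — `¬ ∃ G E, z²·1 = G·Ψ + Φ·E` (any commutative ring `k`);
* `Phi_mulVec_injective`, `sq_z_not_mem_cohomologyAnnihilatorOfDegree` — the U12 theorem.
-/

noncomputable section

-- single-problem summit: the doubled namespace component `ResolutionOfSingularities` is forced
set_option linter.dupNamespace false

namespace Summit.ResolutionOfSingularities.ResolutionOfSingularities.Theorems.HomologicalConductor.LossSpecimenA3

open Literature.RingTheory.CohomologyAnnihilator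
open Summit.ResolutionOfSingularities.ResolutionOfSingularities.Theorems.HomologicalConductor.LostCertificate
open Summit.ResolutionOfSingularities.ResolutionOfSingularities.Theorems.HomologicalConductor.MatrixFactorisationExact
open MvPolynomial Matrix

universe u

section MF

variable (k : Type u) [CommRing k]

/-- `S = k[x,y,z,t]`. [OURS · L1 w44b] -/
abbrev S : Type u := MvPolynomial (Fin 4) k

/-- `f = xy − z⁴`. [OURS · L1 w44b] -/
def f : S k := X 0 * X 1 - X 2 ^ 4

/-- `Φ = [[zI − tJ, −xI],[yI, −ψ_N]]`. [OURS · L1 w44b · U12-SPEC §1] -/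
def Phi : Matrix (Fin 6) (Fin 6) (S k) :=
  !![X 2, -X 3, 0, -X 0, 0, 0;
     0, X 2, -X 3, 0, -X 0, 0;
     0, 0, X 2, 0, 0, -X 0;
     X 1, 0, 0, -(X 2 ^ 3), -(X 2 ^ 2 * X 3), -(X 2 * X 3 ^ 2);
     0, X 1, 0, 0, -(X 2 ^ 3), -(X 2 ^ 2 * X 3);
     0, 0, X 1, 0, 0, -(X 2 ^ 3)]

/-- `Ψ = [[−ψ_N, xI],[−yI, zI − tJ]]`. [OURS · L1 w44b · U12-SPEC §1] -/
def Psi : Matrix (Fin 6) (Fin 6) (S k) :=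
  !![-(X 2 ^ 3), -(X 2 ^ 2 * X 3), -(X 2 * X 3 ^ 2), X 0, 0, 0;
     0, -(X 2 ^ 3), -(X 2 ^ 2 * X 3), 0, X 0, 0;
     0, 0, -(X 2 ^ 3), 0, 0, X 0;
     -X 1, 0, 0, X 2, -X 3, 0;
     0, -X 1, 0, 0, X 2, -X 3;
     0, 0, -X 1, 0, 0, X 2]

/-- FACT 1a: `Φ·Ψ = (xy − z⁴)·I₆`. [OURS · L1 w44b · U12-SPEC §1] -/
theorem Phi_mul_Psi : Phi k * Psi k = f k • (1 : Matrix (Fin 6) (Fin 6) (S k)) := by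
  ext i j
  fin_cases i <;> fin_cases j <;>
    simp [Phi, Psi, f, Matrix.mul_apply, Fin.sum_univ_succ] <;> ring

/-- FACT 1b: `Ψ·Φ = (xy − z⁴)·I₆`. [OURS · L1 w44b · U12-SPEC §1] -/
theorem Psi_mul_Phi : Psi k * Phi k = f k • (1 : Matrix (Fin 6) (Fin 6) (S k)) := by
  ext i j
  fin_cases i <;> fin_cases j <;>
    simp [Phi, Psi, f, Matrix.mul_apply, Fin.sum_univ_succ] <;> ring

end MF

/-! ## The certificate `μ = coeff_{t²}(·₁₃) + coeff_{zt}(·₂₃) + coeff_{z²}(·₃₃)` -/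

section Certificate

variable {k : Type u} [CommRing k]

/-- `coeff_m (X i · p) = 0` when `m i = 0`. [OURS · L1 w44b] -/
theorem coeff_X_mul_of_apply_eq_zero {m : Fin 4 →₀ ℕ} {i : Fin 4} (h : m i = 0) (p : S k) :
    coeff m (X i * p) = 0 := by
  classical
  rw [coeff_X_mul', if_neg (by rwa [Finsupp.mem_support_iff, not_not])]

/-- `coeff_m (X i · p) = coeff_{m − eᵢ} p` when `m i ≠ 0`. [OURS · L1 w44b] -/
theorem coeff_X_mul_of_apply_ne_zero {m : Fin 4 →₀ ℕ} {i : Fin 4} (h : m i ≠ 0) (p : S k) :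
    coeff m (X i * p) = coeff (m - Finsupp.single i 1) p := by
  classical
  rw [coeff_X_mul', if_pos (by rwa [Finsupp.mem_support_iff])]

/-- `coeff_0 (X i · p) = 0`. [OURS · L1 w44b] -/
theorem coeff_zero_X_mul' (i : Fin 4) (p : S k) : coeff 0 (X i * p) = 0 :=
  coeff_X_mul_of_apply_eq_zero (by simp) p

/-- `e_t² − e_t = e_t`. [OURS · L1 w44b] -/
theorem single_three_two_sub :
    (Finsupp.single (3 : Fin 4) 2 - Finsupp.single 3 1 : Fin 4 →₀ ℕ) = Finsupp.single 3 1 := by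
  ext a; fin_cases a <;> simp

/-- `(e_z + e_t) − e_z = e_t`. [OURS · L1 w44b] -/
theorem single_two_add_three_sub_two :
    (Finsupp.single (2 : Fin 4) 1 + Finsupp.single 3 1 - Finsupp.single 2 1 : Fin 4 →₀ ℕ) = Finsupp.single 3 1 := by
  ext a; fin_cases a <;> simp

/-- `(e_z + e_t) − e_t = e_z`. [OURS · L1 w44b] -/
theorem single_two_add_three_sub_three :
    (Finsupp.single (2 : Fin 4) 1 + Finsupp.single 3 1 - Finsupp.single 3 1 : Fin 4 →₀ ℕ) = Finsupp.single 2 1 := by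
  ext a; fin_cases a <;> simp

/-- `e_z² − e_z = e_z`. [OURS · L1 w44b] -/
theorem single_two_two_sub :
    (Finsupp.single (2 : Fin 4) 2 - Finsupp.single 2 1 : Fin 4 →₀ ℕ) = Finsupp.single 2 1 := by
  ext a; fin_cases a <;> simp

/-- `e_i − e_i = 0`. [OURS · L1 w44b] -/
theorem single_sub_self (i : Fin 4) : (Finsupp.single i 1 - Finsupp.single i 1 : Fin 4 →₀ ℕ) = 0 :=
  tsub_self _

/-- **No certificate for `z²`** (U12-SPEC §2): over any commutative ring `k` with `1 ≠ 0` there are no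
`G, E ∈ M₆(k[x,y,z,t])` with `z²·I₆ = G·Ψ + Φ·E`. The functional
`μ = coeff_{t²}(·₁₃) + coeff_{zt}(·₂₃) + coeff_{z²}(·₃₃)` vanishes on `GΨ` (column 3 of `Ψ` is
`(−zt², −z²t, −z³, 0, 0, −y)`) and on `ΦE` (telescoping), but `μ(z²I₆) = 1`. [OURS · L1 w44b] -/
theorem no_certificate [Nontrivial k] :
    ¬ ∃ G E : Matrix (Fin 6) (Fin 6) (S k),
      (X 2 ^ 2 : S k) • (1 : Matrix (Fin 6) (Fin 6) (S k)) = G * Psi k + Phi k * E := by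
  classical
  rintro ⟨G, E, h⟩
  -- the three entries (0,2), (1,2), (2,2) of the identity, in telescoped form
  have h02 := congrArg (fun M : Matrix (Fin 6) (Fin 6) (S k) => M 0 2) h
  have h12 := congrArg (fun M : Matrix (Fin 6) (Fin 6) (S k) => M 1 2) h
  have h22 := congrArg (fun M : Matrix (Fin 6) (Fin 6) (S k) => M 2 2) h
  simp only [Matrix.add_apply, Matrix.mul_apply, Matrix.smul_apply, Fin.sum_univ_succ, Fin.sum_univ_zero] at h02 h12 h22
  simp [Phi, Psi] at h02 h12 h22
  have e02 : X 2 * E 0 2 = X 3 * E 1 2 + X 0 * E 3 2 + X 2 * (X 3 * (X 3 * G 0 0)) +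
      X 2 * (X 2 * (X 3 * G 0 1)) + X 2 * (X 2 * (X 2 * G 0 2)) + X 1 * G 0 5 := by
    linear_combination (-1 : S k) * h02
  have e12 : X 2 * E 1 2 = X 3 * E 2 2 + X 0 * E 4 2 + X 2 * (X 3 * (X 3 * G 1 0)) +
      X 2 * (X 2 * (X 3 * G 1 1)) + X 2 * (X 2 * (X 2 * G 1 2)) + X 1 * G 1 5 := by
    linear_combination (-1 : S k) * h12
  have e22 : (X 2 ^ 2 : S k) + X 0 * E 5 2 + X 2 * (X 3 * (X 3 * G 2 0)) +
      X 2 * (X 2 * (X 3 * G 2 1)) + X 2 * (X 2 * (X 2 * G 2 2)) + X 1 * G 2 5 = X 2 * E 2 2 := by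
    linear_combination h22
  -- μ₁ = coeff_{t²} of (0,2): coeff_t (E 1 2) = 0
  have c1 : coeff (Finsupp.single (3 : Fin 4) 1) (E 1 2) = 0 := by
    have := congrArg (coeff (Finsupp.single (3 : Fin 4) 2)) e02
    simp only [coeff_add] at this
    rw [coeff_X_mul_of_apply_eq_zero (i := 2) (by simp),
      coeff_X_mul_of_apply_ne_zero (i := 3) (by simp), single_three_two_sub,
      coeff_X_mul_of_apply_eq_zero (i := 0) (by simp),
      coeff_X_mul_of_apply_eq_zero (i := 2) (by simp),
      coeff_X_mul_of_apply_eq_zero (i := 2) (by simp),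
      coeff_X_mul_of_apply_eq_zero (i := 2) (by simp),
      coeff_X_mul_of_apply_eq_zero (i := 1) (by simp)] at this
    simpa using this.symm
  -- μ₂ = coeff_{zt} of (1,2): coeff_t (E 1 2) = coeff_z (E 2 2)
  have c2 : coeff (Finsupp.single (3 : Fin 4) 1) (E 1 2) = coeff (Finsupp.single (2 : Fin 4) 1) (E 2 2) := by
    have := congrArg (coeff (Finsupp.single (2 : Fin 4) 1 + Finsupp.single 3 1)) e12
    simp only [coeff_add] at this
    rw [coeff_X_mul_of_apply_ne_zero (i := 2) (by simp), single_two_add_three_sub_two,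
      coeff_X_mul_of_apply_ne_zero (i := 3) (by simp), single_two_add_three_sub_three,
      coeff_X_mul_of_apply_eq_zero (i := 0) (by simp),
      coeff_X_mul_of_apply_ne_zero (i := 2) (m := Finsupp.single 2 1 + Finsupp.single 3 1)
        (by simp), single_two_add_three_sub_two,
      coeff_X_mul_of_apply_ne_zero (i := 3) (m := Finsupp.single 3 1) (by simp),
      single_sub_self, coeff_zero_X_mul',
      coeff_X_mul_of_apply_ne_zero (i := 2) (m := Finsupp.single 2 1 + Finsupp.single 3 1)
        (by simp), single_two_add_three_sub_two,
      coeff_X_mul_of_apply_eq_zero (i := 2) (m := Finsupp.single 3 1) (by simp),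
      coeff_X_mul_of_apply_ne_zero (i := 2) (m := Finsupp.single 2 1 + Finsupp.single 3 1)
        (by simp), single_two_add_three_sub_two,
      coeff_X_mul_of_apply_eq_zero (i := 2) (m := Finsupp.single 3 1) (by simp),
      coeff_X_mul_of_apply_eq_zero (i := 1) (by simp)] at this
    simpa using this
  -- μ₃ = coeff_{z²} of (2,2): 1 = coeff_z (E 2 2)
  have c3 : (1 : k) = coeff (Finsupp.single (2 : Fin 4) 1) (E 2 2) := by
    have := congrArg (coeff (Finsupp.single (2 : Fin 4) 2)) e22
    simp only [coeff_add] at this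
    rw [coeff_X_pow, if_pos rfl,
      coeff_X_mul_of_apply_eq_zero (i := 0) (by simp),
      coeff_X_mul_of_apply_ne_zero (i := 2) (m := Finsupp.single 2 2) (by simp),
      single_two_two_sub,
      coeff_X_mul_of_apply_eq_zero (i := 3) (m := Finsupp.single 2 1) (by simp),
      coeff_X_mul_of_apply_ne_zero (i := 2) (m := Finsupp.single 2 2) (by simp),
      single_two_two_sub,
      coeff_X_mul_of_apply_ne_zero (i := 2) (m := Finsupp.single 2 1) (by simp),
      single_sub_self, coeff_zero_X_mul',
      coeff_X_mul_of_apply_ne_zero (i := 2) (m := Finsupp.single 2 2) (by simp),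
      single_two_two_sub,
      coeff_X_mul_of_apply_ne_zero (i := 2) (m := Finsupp.single 2 1) (by simp),
      single_sub_self, coeff_zero_X_mul',
      coeff_X_mul_of_apply_eq_zero (i := 1) (by simp),
      coeff_X_mul_of_apply_ne_zero (i := 2) (m := Finsupp.single 2 2) (by simp),
      single_two_two_sub] at this
    simpa using this
  rw [← c2, c1] at c3
  exact one_ne_zero c3

end Certificate

/-! ## The U12 theorem: `z̄² ∉ caⁿ(A₃ × line)` for every `n` -/

section Theorem

variable (k : Type u) [Field k]

open Summit.ResolutionOfSingularities.ResolutionOfSingularities.Theorems.HomologicalConductor.LostAssembly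
open Summit.ResolutionOfSingularities.ResolutionOfSingularities.Theorems.HomologicalConductor.PersistenceStableAnnihilatorMF
open Summit.ResolutionOfSingularities.ResolutionOfSingularities.Theorems.HomologicalConductor.MFCoker

/-- `f = xy − z⁴ ≠ 0` (evaluate at `x = y = t = 0`, `z = 1`), hence a non-zero-divisor of the domain `k[x,y,z,t]`.
[OURS · L1 w44b] -/
theorem f_mem_nonZeroDivisors : f k ∈ nonZeroDivisors (S k) := by
  refine mem_nonZeroDivisors_of_ne_zero fun h => ?_
  have h1 := congrArg (MvPolynomial.aeval ![(0 : k), 0, 1, 0]) h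
  simp [f] at h1

/-- **U12 — the first kernel-certified failure of the product rule for the cohomology annihilator**
(`ca(A₃) ∋ z²` but): for every field `k` and every `n`, the class of `z²` does NOT lie in
`caⁿ(k[x,y,z,t] ⧸ (xy − z⁴))`. Proof: the §H2L pipeline — `coker Φ̄` is a `2n`-th syzygy of itself
(U10a, injectivity form), CA1, U7c (`exists_eq_of_stablyAnnihilates_coker`), and `no_certificate`.
[OURS · L1 w44b · U12-SPEC §3] -/
theorem sq_z_not_mem_cohomologyAnnihilatorOfDegree (n : ℕ) :
    Ideal.Quotient.mk (Ideal.span ({f k} : Set (S k))) (X 2 ^ 2) ∉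
      cohomologyAnnihilatorOfDegree (S k ⧸ Ideal.span ({f k} : Set (S k))) n :=
  not_mem_cohomologyAnnihilatorOfDegree_of_no_certificate' (f k) (f_mem_nonZeroDivisors k) (Phi k) (Psi k)
    (Phi_mul_Psi k) (Psi_mul_Phi k) (X 2 ^ 2)
    (fun h => exists_eq_of_stablyAnnihilates_coker (f k) (f_mem_nonZeroDivisors k) (Phi k) (Psi k)
      (Phi_mul_Psi k) (X 2 ^ 2) h)
    (no_certificate (k := k)) n

/-- The same with the square taken in the quotient ring: `(z̄)² ∉ caⁿ(A₃ × line)`. [OURS · L1 w44b] -/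
theorem mk_z_sq_not_mem_cohomologyAnnihilatorOfDegree (n : ℕ) :
    Ideal.Quotient.mk (Ideal.span ({f k} : Set (S k))) (X 2) ^ 2 ∉
      cohomologyAnnihilatorOfDegree (S k ⧸ Ideal.span ({f k} : Set (S k))) n := by
  rw [← map_pow]
  exact sq_z_not_mem_cohomologyAnnihilatorOfDegree k n

end Theorem

end Summit.ResolutionOfSingularities.ResolutionOfSingularities.Theorems.HomologicalConductor.LossSpecimenA3

end
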